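import Summits.KontsevichZagierPeriods.KontsevichZagierPeriods.Theorems.FurushoPentagonDoubleShuffleInKZReduction
import Summits.KontsevichZagierPeriods.KontsevichZagierPeriods.Theorems.FurushoPentagonHoffmanRelationInKZ

/-!
# `DoubleShuffleInKZ` (stmt-KontsevichZagierPeriods-14665, route `FurushoPentagon`): the instance `l = 1`
# of IKZ's regularised family is Hoffman's relation; the deliverable needs the family for `l ≥ 2` only

Second helper file (`--supports stmt-KontsevichZagierPeriods-14665`), continuing
`FurushoPentagonDoubleShuffleInKZReduction.lean`, where the route item `DoubleShuffleInKZ` is shown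
EQUIVALENT (given the proved crux `StuffleInKZ`) to IKZ's family (v) of [IharaKanekoZagier2006, Thm 2]
in realisation form: `Σ_{u ∈ s ∗ 1ˡ} χ(Z(reg_ш u)) = 0` for all non-empty admissible `s` and all `l ≥ 1`.

Here (pure list combinatorics + the proved crux `HoffmanRelationInKZ`):
* `regularisedFamily_one` — the instance `l = 1` of the family IS Hoffman's relation: `s ∗ (1)` consists of
  the raised indices `s + eᵢ` and the insertions of `1` at the `k + 1` gaps (`sum_map_stuffle_one`); the only
  divergent one is `(1, s)`, where IKZ's Cor. 5 gives `reg_ш(y w_s) = y w_s − y ш w_s`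
  (`shuffleReg_true_false_cons`), i.e. minus the proper insertions of the letter `y` into `w_s`, which read
  (`HoffmanRelationInKZ.shuffleWords_finset`) as Hoffman's split indices plus the inner insertions of the
  index `1`; everything cancels down to `χ(H_Z(s)) = 0`;
* `doubleShuffleInKZ_of_regularisedFamily_two` — hence **the deliverable follows from the family for
  `l ≥ 2` alone**, which is what the tree does not have (by [IharaKanekoZagier2006, Thm 3] it is
  equivalent under FDS to the derivation relations `∂ₙ`, `n ≥ 2`, inside the calculus; `FDS + (v)_{l=1} ⇒ (v)`
  is IKZ's conjectural statement (3), p. 315, not a theorem).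

References: K. Ihara, M. Kaneko, D. Zagier, Compos. Math. 142 (2006), Thm 2 (v), Thm 3, Cor. 5;
M. E. Hoffman, Pacific J. Math. 152 (1992), Thm 5.1; M. E. Hoffman, J. Algebra 194 (1997), §2.
-/

noncomputable section

open scoped BigOperators
open Literature.NumberTheory.Transcendental
open Summit.KontsevichZagierPeriods.KontsevichZagierPeriods.Theses.FurushoPentagon

namespace Summit.KontsevichZagierPeriods.FurushoPentagon.DoubleShuffleInKZ

/-! ## 5. The instance `l = 1` of the family is Hoffman's relation (proved crux) -/

section HoffmanInstance

/-- `[a] ш w` lists the insertions of the letter `a` at the `|w| + 1` gaps of `w`, in order.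
[folklore] -/
theorem shuffleWord_singleton_left {α : Type*} (a : α) : ∀ w : List α,
    MZV.shuffleWord [a] w = (List.range (w.length + 1)).map fun g => w.insertIdx g a
  | [] => rfl
  | b :: w => by
    rw [MZV.shuffleWord_cons_cons, MZV.shuffleWord_nil_left, shuffleWord_singleton_left a w,
      List.length_cons]
    conv_rhs => rw [List.range_succ_eq_map]
    simp only [List.map_cons, List.map_nil, List.cons_append, List.nil_append, List.map_map,
      Function.comp_def, List.insertIdx_succ_cons, List.insertIdx_zero]

open Summit.KontsevichZagierPeriods.FurushoPentagon.HoffmanRelationInKZ (insertIdx_binaryWord) in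
/-- Inserting `y` at a gap `g ∈ {1, …, n}` of the word of a non-empty admissible index (`x … y`) gives a
convergent word (`HoffmanRelationInKZ.insertIdx_binaryWord`: it is non-empty, ends with `y` and does not
begin with `y`). [cite: IharaKanekoZagier2006, §1 (𝔥⁰ = ℚ + x𝔥y)] -/
theorem isConvergentWord_insertIdx_binaryWord {s : List ℕ} (hs : MZV.IsAdmissible s) (hne : s ≠ [])
    (q : Fin (MZV.weight s)) :
    MZV.IsConvergentWord ((MZV.binaryWord s).insertIdx ((q : ℕ) + 1) true) := by
  obtain ⟨h1, h2, h3, -⟩ := insertIdx_binaryWord hs hne q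
  refine Or.inr ⟨?_, h2⟩
  generalize (MZV.binaryWord s).insertIdx ((q : ℕ) + 1) true = w at h1 h3 ⊢
  cases w with
  | nil => exact absurd rfl h1
  | cons b w =>
    cases b with
    | true => exact absurd rfl h3
    | false => rfl

/-- A word beginning with `y` is not convergent. [cite: IharaKanekoZagier2006, §1] -/
theorem not_isConvergentWord_true_cons (w : List Bool) : ¬ MZV.IsConvergentWord (true :: w) := by
  rintro (h | ⟨h, -⟩) <;> simp at h

/-- **IKZ's Corollary 5 at `m = 1`**: `reg_ш(y x w') = y x w' − y ш x w'` for a word `x w'` ending in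
`y` (no trailing `x`, one leading `y`). [cite: IharaKanekoZagier2006, Cor. 5 p. 322] -/
theorem shuffleReg_true_false_cons {w' : List Bool} (hl : (false :: w').getLast? = some true) :
    MZV.shuffleReg (true :: false :: w') =
      Finsupp.single (true :: false :: w') 1 - MZV.shuffleSum [true] (false :: w') := by
  have h1 : MZV.regEnd (true :: false :: w') = Finsupp.single (true :: false :: w') 1 :=
    MZV.regEnd_of_trailingX_eq_zero (MZV.trailingX_eq_zero (by
      rw [List.getLast?_cons_cons]; exact hl))
  have h2 : MZV.leadingY (true :: false :: w') = 1 := by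
    simp [MZV.leadingY]
  rw [MZV.shuffleReg, h1, Finsupp.sum_single_index, one_smul, MZV.regFront, h2,
    Finset.sum_range_succ, Finset.sum_range_one]
  · simp only [pow_zero, one_smul, List.replicate_zero, MZV.shuffleSum_nil_left, List.drop_zero, pow_one,
      neg_smul, List.drop_one, List.tail_cons]
    rw [show List.replicate 1 true = [true] from rfl, sub_eq_add_neg]
  · exact zero_smul _ _

/-- **The stuffle `s ∗ (1)` enumerated**: `Σ_{u ∈ s ∗ (1)} f(u) = f(1 s) + Σ_i f(s + e_i) + Σ_i f(s₁…s_{i+1} 1 …)`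
(the index `1` merged with an entry, or inserted at one of the `k + 1` gaps). [cite: Hoffman1997, §2] -/
theorem sum_map_stuffle_one {M : Type*} [AddCommMonoid M] : ∀ (t : List ℕ) (f : List ℕ → M),
    ((MZV.stuffle t [1]).map f).sum = f (1 :: t) +
      ∑ i ∈ Finset.range t.length, f (t.take i ++ [t.getD i 0 + 1] ++ t.drop (i + 1)) +
      ∑ i ∈ Finset.range t.length, f (t.take (i + 1) ++ [1] ++ t.drop (i + 1))
  | [], f => by simp
  | a :: t, f => by
    rw [MZV.stuffle_cons_cons, MZV.stuffle_nil_right, MZV.stuffle_nil_right, List.map_append,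
      List.map_append, List.sum_append, List.sum_append, List.map_map,
      sum_map_stuffle_one t (f ∘ List.cons a), List.length_cons,
      Finset.sum_range_succ' (fun i => f ((a :: t).take i ++ [(a :: t).getD i 0 + 1] ++ (a :: t).drop (i + 1))),
      Finset.sum_range_succ' (fun i => f ((a :: t).take (i + 1) ++ [1] ++ (a :: t).drop (i + 1)))]
    simp only [Function.comp_apply, List.map_cons, List.map_nil, List.sum_cons, List.sum_nil, add_zero,
      List.take_succ_cons, List.take_zero, List.getD_cons_succ, List.getD_cons_zero, List.drop_succ_cons,
      List.drop_zero, List.cons_append, List.nil_append]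
    abel

open Summit.KontsevichZagierPeriods.HoffmanRelationInKZ.Negative (hoffmanElement hoffmanRelationInKZ_iff
  isAdmissible_raise raise list_sum_range_map_finset) in
open Summit.KontsevichZagierPeriods.FurushoPentagon.HoffmanRelationInKZ (isAdmissible_insertOne
  shuffleWords_finset) in
/-- **The instance `l = 1` of IKZ's family is Hoffman's relation.** Given `HoffmanRelationInKZ` (it holds:
`HoffmanRelationInKZ.hoffmanRelationInKZ_proof`), for every realisation `χ`, every pinned `Z` and every
non-empty admissible `s`: `Σ_{u ∈ s ∗ (1)} χ(Z(reg_ш u)) = 0`.  Indeed `s ∗ (1)` = the raised indices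
`s + eᵢ` + the insertions of `1` at the gaps; the only divergent one is `(1, s)`, and
`reg_ш(y w_s) = y w_s − y ш w_s` is minus the sum of the PROPER insertions of the letter `y` into
`w_s`, which read (`HoffmanRelationInKZ.stub_shuffleWords`) as Hoffman's split indices plus the insertions
of the index `1` at the inner gaps; everything cancels down to `χ(H_Z(s)) = 0`.
[cite: IharaKanekoZagier2006, Thm 2 (v) (m = 1); Hoffman1992, Thm 5.1] -/
theorem regularisedFamily_one (hH : HoffmanRelationInKZ) :
    ∀ (R : Type) [CommRing R] [Algebra ℚ R] (χ : KZ.FormalRep →+ R),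
      (∀ c ∈ KZ.relations, χ c = 0) → ∀ Z : List ℕ → KZ.FormalRep,
      (∀ (u : List ℕ) (hu : MZV.IsAdmissible u), Z u = KZ.of (KZ.mzvRep u hu
        (KZ.mzvIntegrand_isSemialgebraicFunOn_holds u) (KZ.mzvIntegrand_integrableOn_holds u hu))) →
      ∀ s : List ℕ, MZV.IsAdmissible s → s ≠ [] →
        ((MZV.stuffle s (List.replicate 1 1)).map fun u =>
          (MZV.shuffleReg (MZV.binaryWord u)).sum fun v a =>
            a • (if MZV.IsConvergentWord v then χ (Z (MZV.ofBinaryWord v)) else (0 : R))).sum = 0 := by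
  intro R _ _ χ hrel Z hZ s hs hne
  set ψ : List Bool → R := fun v => if MZV.IsConvergentWord v then χ (Z (MZV.ofBinaryWord v)) else 0
    with hψ
  -- `f u = ⟨ψ, reg_ш(binaryWord u)⟩`; on admissible `u` it is `χ (Z u)`
  have hadm : ∀ u : List ℕ, MZV.IsAdmissible u →
      Shuffle.pair ψ (MZV.shuffleReg (MZV.binaryWord u)) = χ (Z u) := by
    intro u hu
    rw [pair_shuffleReg_binaryWord ψ hu, hψ]
    show (if MZV.IsConvergentWord (MZV.binaryWord u) then
      χ (Z (MZV.ofBinaryWord (MZV.binaryWord u))) else 0) = χ (Z u)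
    rw [if_pos (MZV.isConvergentWord_binaryWord hu), MZV.ofBinaryWord_binaryWord hu.1]
  -- the divergent index `(1, s)`: `⟨ψ, reg_ш(y w_s)⟩ = −(splits + inner insertions)`
  obtain ⟨a, s', rfl⟩ := List.exists_cons_of_ne_nil hne
  have ha : 2 ≤ a := by simpa using hs.2 (List.cons_ne_nil a s')
  obtain ⟨w', hw'⟩ : ∃ w', MZV.binaryWord (a :: s') = false :: w' := by
    have hh := MZV.head?_binaryWord (s := s') ha
    cases hb : MZV.binaryWord (a :: s') with
    | nil => rw [hb] at hh; simp at hh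
    | cons b w' =>
      rw [hb] at hh
      simp only [List.head?_cons, Option.some.injEq] at hh
      exact ⟨w', by rw [hh]⟩
  have hlast : (MZV.binaryWord (a :: s')).getLast? = some true :=
    MZV.getLast?_binaryWord (List.cons_ne_nil a s')
  have hlen : (MZV.binaryWord (a :: s')).length = MZV.weight (a :: s') := MZV.length_binaryWord hs.1
  have hψ0 : ∀ v : List Bool, ψ (true :: v) = 0 := fun v => if_neg (not_isConvergentWord_true_cons v)
  have hψ1 : ∀ v : List Bool, MZV.IsConvergentWord v → ψ v = χ (Z (MZV.ofBinaryWord v)) :=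
    fun v hv => if_pos hv
  have hreg : MZV.shuffleReg (true :: MZV.binaryWord (a :: s')) =
      Finsupp.single (true :: MZV.binaryWord (a :: s')) 1 -
        MZV.shuffleSum [true] (MZV.binaryWord (a :: s')) := by
    rw [hw']
    exact shuffleReg_true_false_cons (by rw [← hw']; exact hlast)
  have hdiv : Shuffle.pair ψ (MZV.shuffleReg (MZV.binaryWord (1 :: a :: s'))) =
      -(∑ i ∈ Finset.range (a :: s').length, ∑ j ∈ Finset.range ((a :: s').getD i 0 - 1),
          χ (Z ((a :: s').take i ++ [(a :: s').getD i 0 - j, j + 1] ++ (a :: s').drop (i + 1))) +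
        ∑ i ∈ Finset.range (a :: s').length,
          χ (Z ((a :: s').take (i + 1) ++ [1] ++ (a :: s').drop (i + 1)))) := by
    rw [← shuffleWords_finset (a :: s') hs.1 (fun u => χ (Z u))]
    have hbw : MZV.binaryWord (1 :: a :: s') = true :: MZV.binaryWord (a :: s') := by
      simp [MZV.binaryWord]
    have hpn : Shuffle.pair ψ (-MZV.shuffleSum [true] (MZV.binaryWord (a :: s'))) =
        -Shuffle.pair ψ (MZV.shuffleSum [true] (MZV.binaryWord (a :: s'))) := by
      rw [← neg_one_smul ℚ (MZV.shuffleSum [true] (MZV.binaryWord (a :: s'))), Shuffle.pair_smul,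
        neg_one_smul]
    rw [hbw, hreg, sub_eq_add_neg, Shuffle.pair_add, hpn, Shuffle.pair_single, one_smul, MZV.shuffleSum,
      ← Shuffle.wordSum_eq_MZV, Shuffle.pair_wordSum, shuffleWord_singleton_left, List.map_map,
      list_sum_range_map_finset, Finset.sum_range_succ', hlen]
    simp only [Function.comp_apply, List.insertIdx_zero, hψ0, zero_add, add_zero, neg_inj]
    refine Finset.sum_congr rfl fun g hg => hψ1 _ ?_
    exact isConvergentWord_insertIdx_binaryWord hs (List.cons_ne_nil a s') ⟨g, Finset.mem_range.mp hg⟩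
  -- assemble: raises − splits is Hoffman's element, a relation
  have hH' := hrel _ ((hoffmanRelationInKZ_iff.mp hH) Z hZ (a :: s') hs)
  simp only [hoffmanElement, map_sub, list_sum_range_map_finset, map_sum] at hH'
  rw [show List.replicate 1 1 = [1] from rfl]
  change ((MZV.stuffle (a :: s') [1]).map fun u => Shuffle.pair ψ (MZV.shuffleReg (MZV.binaryWord u))).sum = 0
  rw [sum_map_stuffle_one, hdiv,
    Finset.sum_congr rfl fun i hi => hadm ((a :: s').take i ++ [(a :: s').getD i 0 + 1] ++ (a :: s').drop (i + 1))
      (isAdmissible_raise hs (Finset.mem_range.mp hi)),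
    Finset.sum_congr rfl fun i _ => hadm ((a :: s').take (i + 1) ++ [1] ++ (a :: s').drop (i + 1))
      (isAdmissible_insertOne hs (List.cons_ne_nil a s') i).1]
  linear_combination hH'

end HoffmanInstance

/-! ## 6. What exactly is missing: the family for `l ≥ 2` -/

/-- **`DoubleShuffleInKZ` ⇐ IKZ's family (v) for `l ≥ 2` only.** The case `l = 1` is discharged by the
proved crux `HoffmanRelationInKZ` (`regularisedFamily_one`), the convergent stuffle by the proved crux
`StuffleInKZ`; what remains — and is NOT in the tree — is `Σ_{u ∈ s ∗ 1ˡ} χ(Z(reg_ш u)) = 0` for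
`l ≥ 2` (by [IharaKanekoZagier2006, Thm 3] equivalent, under FDS, to the derivation relations `∂ₙ`,
`n ≥ 2`, inside the calculus). [cite: IharaKanekoZagier2006, Thm 2 (v), Thm 3] -/
theorem doubleShuffleInKZ_of_regularisedFamily_two
    (hV : ∀ (R : Type) [CommRing R] [Algebra ℚ R] (χ : KZ.FormalRep →+ R),
      (∀ c ∈ KZ.relations, χ c = 0) → (∀ a b : KZ.FormalRep, χ (a * b) = χ a * χ b) →
      (∃ u : KZ.FormalRep, χ u = 1) → ∀ Z : List ℕ → KZ.FormalRep,
      (∀ (u : List ℕ) (hu : MZV.IsAdmissible u), Z u = KZ.of (KZ.mzvRep u hu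
        (KZ.mzvIntegrand_isSemialgebraicFunOn_holds u) (KZ.mzvIntegrand_integrableOn_holds u hu))) →
      ∀ s : List ℕ, MZV.IsAdmissible s → s ≠ [] → ∀ l : ℕ, 2 ≤ l →
        ((MZV.stuffle s (List.replicate l 1)).map fun u =>
          (MZV.shuffleReg (MZV.binaryWord u)).sum fun v a =>
            a • (if MZV.IsConvergentWord v then χ (Z (MZV.ofBinaryWord v)) else (0 : R))).sum = 0) :
    DoubleShuffleInKZ :=
  doubleShuffleInKZ_of_regularisedFamily fun R _ _ χ hrel hmul hunit Z hZ s hs hne l hl => by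
    rcases Nat.lt_or_ge l 2 with h1 | h2
    · obtain rfl : l = 1 := by omega
      exact regularisedFamily_one HoffmanRelationInKZ.hoffmanRelationInKZ_proof R χ hrel Z hZ s hs hne
    · exact hV R χ hrel hmul hunit Z hZ s hs hne l h2

end Summit.KontsevichZagierPeriods.FurushoPentagon.DoubleShuffleInKZ
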